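import Mathlib
import Summits.Ventures.PercRepro2.Defs
import Summits.Ventures.PercRepro2.Harris
import Summits.Ventures.PercRepro2.Graph
import Summits.Ventures.PercRepro2.Induced
import Summits.Ventures.PercRepro2.VdBKahn
import Summits.Ventures.PercRepro2.ReimerVdBK

/-!
# `(R-1.2)` from two conditional-association statements under the symmetric conditioning
(blind cell PercRepro2, mine-c g43; `conjectures/MINE-C.md` §52.4)

Write `Z = X ∩ Y` and `C_Z = {ω : Z ∩ K₁ = ∅ = Z ∩ K₂}` (neither world reaches `Z`); in the
vocabulary of `ReimerVdBK.lean`, `#C_Z = reimerCount ∅ Z ∅ Z`.  The two conjectures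

  **(CNA_Z)**  `Φ(A, X; B, Y) · #C_Z ≤ Φ(A, Z; ∅, Y) · Φ(∅, X; B, Z)`
  **(CPA_Z)**  `Φ(A, Z; ∅, Y) · Φ(B, Z; ∅, X) ≤ Φ(A ∪ B, Z; ∅, X ∪ Y) · #C_Z`

say that, given `C_Z`, the upper two-world cluster event `U₁ = {A ⊆ K₁, Y' ∩ K₂ = ∅}` is negatively
associated with the lower event `L₁ = {X' ∩ K₁ = ∅, B ⊆ K₂}` and positively associated with the
upper event `bar L₁ = {B ⊆ K₁, X' ∩ K₂ = ∅}` (`MINE-C.md` §52.4: 0 violations in 20,480,000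
instances on all graphs with ≤ 5 vertices; both FAIL under any asymmetric conditioning).  The world
swap `Φ(∅, X; B, Z) = Φ(B, Z; ∅, X)` (`reimerCount_swap`, from `count_bar`) chains them into
`Φ(A, X; B, Y) · #C_Z ≤ Φ(A ∪ B, Z; ∅, X ∪ Y) · #C_Z`, and cancelling `#C_Z` — or using
`Φ(A, X; B, Y) ≤ #C_Z` when `#C_Z = 0` — gives `(R-1.2)`: `rvdBK_of_cna_cpa`.
-/

namespace Summit.Ventures.PercRepro2

namespace ReimerVdBK

open Classical

variable {V : Type*} {E : Type*} [Fintype E] [DecidableEq E] [Fintype V] [DecidableEq V]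

variable (ends : E → Sym2 V) (s : V)

omit [Fintype E] [DecidableEq E] [Fintype V] [DecidableEq V] in
/-- Swapping the two worlds: `twoWorld B Y A X` is the world-2 image of `twoWorld A X B Y`. -/
lemma twoWorld_swap (A X B Y : Finset V) :
    twoWorld ends s B Y A X = bar (twoWorld ends s A X B Y) := by
  ext ω
  simp only [twoWorld, mem_bar, Set.mem_inter_iff, compl_compl]
  tauto

omit [Fintype V] [DecidableEq V] in
/-- **World swap**: `Φ(A, X; B, Y) = Φ(B, Y; A, X)`. -/
lemma reimerCount_swap (A X B Y : Finset V) :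
    reimerCount ends s A X B Y = reimerCount ends s B Y A X := by
  unfold reimerCount
  rw [twoWorld_swap, count_bar]

omit [Fintype E] [DecidableEq E] [Fintype V] [DecidableEq V] in
/-- `R_X ⊆ R_{X'}` when `X' ⊆ X`. -/
lemma avoidAll_anti {X X' : Finset V} (h : X' ⊆ X) : avoidAll ends s X ⊆ avoidAll ends s X' :=
  fun _ hω x hx => hω x (h hx)

omit [Fintype E] [DecidableEq E] [Fintype V] [DecidableEq V] in
/-- `Q_A ⊆ Q_{A'}` when `A' ⊆ A`. -/
lemma connAll_anti {A A' : Finset V} (h : A' ⊆ A) : connAll ends s A ⊆ connAll ends s A' :=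
  fun _ hω a ha => hω a (h ha)

omit [Fintype E] [DecidableEq E] [Fintype V] [DecidableEq V] in
/-- Monotonicity of the two-world event in all four sets. -/
lemma twoWorld_mono {A A' X X' B B' Y Y' : Finset V} (hA : A' ⊆ A) (hX : X' ⊆ X) (hB : B' ⊆ B)
    (hY : Y' ⊆ Y) : twoWorld ends s A X B Y ⊆ twoWorld ends s A' X' B' Y' := by
  unfold twoWorld
  intro ω ⟨⟨h1, h2⟩, h3⟩
  refine ⟨⟨connAll_anti ends s hA h1, avoidAll_anti ends s hX h2⟩, ?_⟩
  rw [mem_bar] at h3 ⊢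
  exact ⟨connAll_anti ends s hB h3.1, avoidAll_anti ends s hY h3.2⟩

omit [Fintype V] [DecidableEq V] in
/-- Monotonicity of the Reimer count in all four sets. -/
lemma reimerCount_mono {A A' X X' B B' Y Y' : Finset V} (hA : A' ⊆ A) (hX : X' ⊆ X) (hB : B' ⊆ B)
    (hY : Y' ⊆ Y) : reimerCount ends s A X B Y ≤ reimerCount ends s A' X' B' Y' :=
  count_mono (twoWorld_mono ends s hA hX hB hY)

/-- **(CNA_Z)**: given that neither world reaches `Z = X ∩ Y`, the upper event
`{A ⊆ K₁, Y ∩ K₂ = ∅}` and the lower event `{X ∩ K₁ = ∅, B ⊆ K₂}` are negatively associated: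
`Φ(A, X; B, Y) · #C_Z ≤ Φ(A, Z; ∅, Y) · Φ(∅, X; B, Z)` (conjecture, `MINE-C.md` §52.4). -/
def CNA (A X B Y : Finset V) : Prop :=
  reimerCount ends s A X B Y * reimerCount ends s ∅ (X ∩ Y) ∅ (X ∩ Y) ≤
    reimerCount ends s A (X ∩ Y) ∅ Y * reimerCount ends s ∅ X B (X ∩ Y)

/-- **(CPA_Z)**: given that neither world reaches `Z = X ∩ Y`, the upper events
`{A ⊆ K₁, Y ∩ K₂ = ∅}` and `{B ⊆ K₁, X ∩ K₂ = ∅}` are positively associated: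
`Φ(A, Z; ∅, Y) · Φ(B, Z; ∅, X) ≤ Φ(A ∪ B, Z; ∅, X ∪ Y) · #C_Z` (conjecture, `MINE-C.md` §52.4). -/
def CPA (A X B Y : Finset V) : Prop :=
  reimerCount ends s A (X ∩ Y) ∅ Y * reimerCount ends s B (X ∩ Y) ∅ X ≤
    reimerCount ends s (A ∪ B) (X ∩ Y) ∅ (X ∪ Y) * reimerCount ends s ∅ (X ∩ Y) ∅ (X ∩ Y)

omit [Fintype V] in
/-- **`(CNA_Z)` and `(CPA_Z)` give `(R-1.2)`**: chain the two product inequalities through the world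
swap `Φ(∅, X; B, Z) = Φ(B, Z; ∅, X)` and cancel `#C_Z` (when `#C_Z = 0` the left side of `(R-1.2)`
is `0` too, since its event lies in `C_Z`). -/
theorem rvdBK_of_cna_cpa (A X B Y : Finset V) (hcna : CNA ends s A X B Y)
    (hcpa : CPA ends s A X B Y) : RvdBK ends s A X B Y := by
  unfold CNA at hcna
  unfold CPA at hcpa
  unfold RvdBK
  set C := reimerCount ends s ∅ (X ∩ Y) ∅ (X ∩ Y) with hC
  have hswap : reimerCount ends s ∅ X B (X ∩ Y) = reimerCount ends s B (X ∩ Y) ∅ X :=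
    reimerCount_swap ends s ∅ X B (X ∩ Y)
  rw [hswap] at hcna
  have hchain : reimerCount ends s A X B Y * C ≤
      reimerCount ends s (A ∪ B) (X ∩ Y) ∅ (X ∪ Y) * C := hcna.trans hcpa
  rcases Nat.eq_zero_or_pos C with hC0 | hCpos
  · -- the left event lies in `C_Z`, so its count is `≤ #C_Z = 0`
    have hle : reimerCount ends s A X B Y ≤ C :=
      reimerCount_mono ends s (Finset.empty_subset A) Finset.inter_subset_left
        (Finset.empty_subset B) Finset.inter_subset_right
    rw [hC0] at hle
    rw [Nat.le_zero.1 hle]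
    exact Nat.zero_le _
  · exact Nat.le_of_mul_le_mul_right hchain hCpos

end ReimerVdBK

end Summit.Ventures.PercRepro2
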